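import Summits.NavierStokesRegularity.FluidComputer.PalasekTowerRegister
import Summits.NavierStokesRegularity.FluidComputer.PalasekTowerStageUniqueness
import Summits.NavierStokesRegularity.FluidComputer.PalasekTowerViscosity
import Summits.NavierStokesRegularity.NavierStokesRegularity.Theorems.NavierStokesBreakdownR3
import Literature.Analysis.FluidPDE.TaoForcedUniquenessSchwartzForce

/-!
# The CLOSERS of the E–C route over the SPLIT v2.1 register (FluidComputer side, door (b))

Cell `ns-blowup`; typist `ns-blowup-lean` (g2); planner `ns-blowup-plan` (g16) RULINGS STATUS l.999 /
l.1039 (REGISTER v2.1). LABEL: E–C glue (KERNEL). WHAT THIS IS NOT: not Navier–Stokes evidence —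
conditional implications only; nothing is inhabited or asserted.

This file states, in the FluidComputer namespace of the typed chain, the three closers a route glue
needs once route files may import `Summits.NavierStokesRegularity.FluidComputer.*` (gate door (b);
planner l.1073: glue name `…FluidComputer.PalasekTowerClayBridge.navierStokesBreakdownR3_of_episodesR`).
Its Theorems-side twin (same statements under `…NavierStokesRegularity.Theorems`, for door (c)) is
`Summits/NavierStokesRegularity/NavierStokesRegularity/Theorems/PalasekEpisodeRegister.lean`.

## What is here

* `navierStokesBreakdownR3_of_palasekStep2` — FALLBACK shape: `PalasekStep2 R` and Tao's forced
  unconditional uniqueness `Literature.Analysis.FluidPDE.tao2011_forced_unconditionalUniqueness_velocity`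
  (W14/W21′, a Literature named fact, UNPROVED, hypothesis) give `NavierStokesBreakdownR3`
  (Fefferman's (C)), by the landed bridge `navierStokesBreakdownR3_of_step2` fed through
  `tao2011_forced_unconditionalUniqueness_velocity.schwartzForce` (p404747).
* `navierStokesBreakdownR3_of_episodesPinned_at / _one` — generic PREFERRED shape: the re-pinned base
  and induction (`PalasekTowerEpisodesPinned`, p406175) at one viscosity, any rates / registered
  numbers / margin, plus W14 give (C): `nonempty_realisation_of_episodesPinned` (assembly) →
  `palasekStep2_of_realisation` (one viscosity gives all, `PalasekTowerViscosity`) → the bridge.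
* `navierStokesBreakdownR3_of_episodesR` — THE ROUTE'S CLOSER over the items of record of the planner's
  REGISTER v2.1 (`PalasekTowerRegister.lean`: `EpisodeBaseR`, `EpisodeInductionR` = the re-pinned pair
  at `ν = 1`, `TowerRates.wide`, `Λ = 8`, `θ = 6/5`, margin `Margins.register` = `Schedule.Rigid`
  ∧ `CoreLedger`): K1R → K2R → W14 → (C).

* bookkeeping for depth rungs / BC3 skeletons over the register: `Margins.antitone_withStrain`,
  `Margins.antitone_register`, `Margins.antitone_routeMargin` — the route's margin
  `Margins.withStrain (Margins.register R)` is antitone in the level, so `Stage.restrictOfAntitone`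
  (p407651) restricts its stages downward — and the accessors `Stage.routeMargin_rigid /
  _coreLedger / _strain / _τ_eq_sum / _consts`.

Conditional on every hypothesis; nothing is asserted.

References: S. Palasek, arXiv:2605.13827 §3–§4 [cite: Palasek2026ElementaryModel, §3–§4];
C. L. Fefferman, Clay problem description, (C) [cite: FeffermanClay2006, (C)]; T. Tao, Anal. PDE 6
(2013), Cor. 11.4 [cite: Tao2011, Cor. 11.4].
-/

noncomputable section

namespace Summit.NavierStokesRegularity.FluidComputer.PalasekTowerClayBridge

open Literature.Analysis.FluidPDE

/-! ## The closers (route glue targets) -/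

/-- **FALLBACK shape.** Palasek's Step 2 for the rates `R` and Tao's forced unconditional uniqueness
(the Literature named fact `tao2011_forced_unconditionalUniqueness_velocity`, W14 — UNPROVED,
hypothesis) give Fefferman's (C), by the landed bridge `navierStokesBreakdownR3_of_step2` fed through
`tao2011_forced_unconditionalUniqueness_velocity.schwartzForce`. [cite: FeffermanClay2006, (C)] [cite: Tao2011, Cor. 11.4] -/
theorem navierStokesBreakdownR3_of_palasekStep2 (R : TowerRates) (h : PalasekStep2 R)
    (hU : tao2011_forced_unconditionalUniqueness_velocity) :
    Summit.NavierStokesRegularity.NavierStokesRegularity.NavierStokesBreakdownR3 :=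
  navierStokesBreakdownR3_of_step2 R
    (tao2011_forced_unconditionalUniqueness_velocity.schwartzForce hU) h

/-- **Generic PREFERRED shape, any single viscosity.** The re-pinned base and induction at one
viscosity `ν > 0` (any rates, registered numbers, margin) plus W14 give (C).
[cite: FeffermanClay2006, (C)] [cite: Palasek2026ElementaryModel, §4] -/
theorem navierStokesBreakdownR3_of_episodesPinned_at {ν : ℝ} (hν : 0 < ν) {R : TowerRates}
    {Λ θ : ℝ} {m : Margins R} (h₁ : EpisodeBasePinned ν R Λ θ m)
    (h₂ : EpisodeInductionPinned ν R Λ θ m) (hU : tao2011_forced_unconditionalUniqueness_velocity) :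
    Summit.NavierStokesRegularity.NavierStokesRegularity.NavierStokesBreakdownR3 := by
  obtain ⟨W⟩ := nonempty_realisation_of_episodesPinned h₁ h₂
  exact navierStokesBreakdownR3_of_palasekStep2 R (palasekStep2_of_realisation hν W) hU

/-- **Generic PREFERRED shape at unit viscosity.** [cite: FeffermanClay2006, (C)] -/
theorem navierStokesBreakdownR3_of_episodesPinned_one {R : TowerRates} {Λ θ : ℝ} {m : Margins R}
    (h₁ : EpisodeBasePinned 1 R Λ θ m) (h₂ : EpisodeInductionPinned 1 R Λ θ m)
    (hU : tao2011_forced_unconditionalUniqueness_velocity) :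
    Summit.NavierStokesRegularity.NavierStokesRegularity.NavierStokesBreakdownR3 :=
  navierStokesBreakdownR3_of_episodesPinned_at one_pos h₁ h₂ hU

/-- **THE ROUTE'S CLOSER (items of record).** K1R → K2R → W14 → Fefferman's (C).
Conditional on all three hypotheses; none is asserted anywhere. [cite: FeffermanClay2006, (C)]
[cite: Palasek2026ElementaryModel, §4] [cite: Tao2011, Cor. 11.4] -/
theorem navierStokesBreakdownR3_of_episodesR (h₁ : EpisodeBaseR) (h₂ : EpisodeInductionR)
    (hU : tao2011_forced_unconditionalUniqueness_velocity) :
    Summit.NavierStokesRegularity.NavierStokesRegularity.NavierStokesBreakdownR3 :=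
  navierStokesBreakdownR3_of_episodesPinned_one h₁ h₂ hU

/-! ## Register bookkeeping: the route's margin is antitone in the level -/

/-- The strain floor keeps a level-antitone margin level-antitone. [folklore] -/
theorem Margins.antitone_withStrain {R : TowerRates} {m : Margins R} (hm : m.Antitone) :
    (Margins.withStrain m).Antitone :=
  fun S k k' u hk h => ⟨fun j hj => h.1 j (hj.trans hk), hm S k k' u hk h.2⟩

/-- The registered margin (rigidity ∧ core ledger) is antitone in the level. [folklore] -/
theorem Margins.antitone_register (R : TowerRates) : (Margins.register R).Antitone :=
  fun _ _ _ _ hk h => Margins.register_mono hk h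

/-- Hence the route's margin `withStrain (register R)` is antitone: stages restrict downward
(`Stage.restrictOfAntitone`). [folklore] -/
theorem Margins.antitone_routeMargin (R : TowerRates) :
    (Margins.withStrain (Margins.register R)).Antitone :=
  Margins.antitone_withStrain (Margins.antitone_register R)

/-! ## Accessors for stages carrying the route's margin `withStrain (register R)` -/

namespace Stage

variable {ν : ℝ} {R : TowerRates} {S : Schedule R} {k : ℕ}

/-- A stage with the route's margin sits in a rigid schedule (window equality, registered
constants). [folklore] -/
theorem routeMargin_rigid (s : Stage ν R S (Margins.withStrain (Margins.register R)) k) : S.Rigid :=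
  s.margin.2.1

/-- … carries the core ledger at every grown level. [folklore] -/
theorem routeMargin_coreLedger (s : Stage ν R S (Margins.withStrain (Margins.register R)) k) :
    CoreLedger R S k s.u :=
  s.margin.2.2

/-- … and the strain floors. [folklore] -/
theorem routeMargin_strain (s : Stage ν R S (Margins.withStrain (Margins.register R)) k) :
    ∀ j, j ≤ k → ∃ x, ‖x‖ ≤ S.radius ∧ S.c₁ * R.A j ≤ ‖fderiv ℝ (s.u (S.τ j)) x‖ :=
  s.margin.1

/-- Its readout times are the window schedule from `τ 0`:
`τ (j+1) = τ 0 + Σ_{i ≤ j} c₅ log N_{i+1} / A_i`. [folklore] -/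
theorem routeMargin_τ_eq_sum (s : Stage ν R S (Margins.withStrain (Margins.register R)) k) (j : ℕ) :
    S.τ (j + 1) = S.τ 0 + ∑ i ∈ Finset.range (j + 1), S.c₅ * Real.log (R.N (i + 1)) / R.A i :=
  s.routeMargin_rigid.τ_eq_sum j

/-- Its floor and ceiling constants are the registered numbers `c₁ = 1`, `c₂ = 5/3`. [folklore] -/
theorem routeMargin_consts (s : Stage ν R S (Margins.withStrain (Margins.register R)) k) :
    S.c₁ = 1 ∧ S.c₂ = 5 / 3 ∧ S.c₅ = 4 * R.b * R.β :=
  ⟨s.routeMargin_rigid.c₁_eq, s.routeMargin_rigid.c₂_eq, s.routeMargin_rigid.c₅_eq⟩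

end Stage

end Summit.NavierStokesRegularity.FluidComputer.PalasekTowerClayBridge

end
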